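import Summits.QuantumFields.YangMills.Theorems.SteinGapBootstrapFreeProbeLawGAssemblyMain
import Summits.QuantumFields.YangMills.Theorems.SteinGapBootstrapFreeProbeLawGAssemblyMono
import HarnessLib

/-!
# Crux U `FreeProbeLawG` (stmt-QuantumFields-23756), line `birth` — the registered stub `stub_assembly` (PROVED)

Lead `ym-line-sgb-k1-g1`. The last stub of the line: the single-edge Schwinger–Dyson identities with rate (`stub_sdRate`), the truncated
Green `1`-forms (`stub_blockGreen`) and the field bounds (`stub_fieldBounds`) turn the sharp budget of a torus-limit state into the
conclusion of C1ᶠ `PairSteinDiscrepancyFreeG`: the pair law of the rescaled comb-gauge plaquette field at the two `(1,2)`-plaquettes `0`,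
`n e₀` nearly annihilates the lattice-Maxwell block Ornstein–Uhlenbeck generator, at rate `C (1+n)^K β^(−δ) (1+M)`. Proof: the raw bound
(`AssemblyMain.raw_bound`) at truncation radius `R = ⌈β^κ₀⌉₊ + 2n + 2`, Gaussian-weight scale `δ = β^(−2d₀)` and AM–GM parameter
`λ = β^(l₀)`, with `κ₀ = κsd/(8(deg+1))`, `d₀ = κsd/4`, `l₀ = min(κ, κ₀γ, d₀)/2`, `deg = csd + 2cg + cm + 8` (exponents made non-negative
first); every term is a monomial `a P^N β^e` with `P = 1 + R ≤ 8(1+n)β^κ₀` and `e + κ₀ N ≤ −l₀` (`mono_le`).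
HONEST LABEL: the route `SteinGapBootstrap` closes the RECORD rung R2ξ-G (`WeakCouplingRates.XiPow`, an upper bound on the lattice gap)
conditionally on U; nothing here bears on the Yang–Mills mass gap itself.
References: E. Meckes, IMS Coll. 5 (2009), Lemma 1 [Meckes2009]; S. Chatterjee, arXiv:1602.01222, §11 [arXiv160201222].
-/

set_option autoImplicit false

noncomputable section

open MeasureTheory Finset
open Literature.Probability.LatticeModels Literature.MathematicalPhysics.QuantumLattice
open Literature.MathematicalPhysics.QuantumFieldTheory hiding ZdEdge IsLocalObservable IsInfiniteVolumeLimit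
open Summit.QuantumFields.YangMills.Theorems.EquipartitionPinsProbe

namespace Summit.QuantumFields.YangMills.Cruxes.FreeProbeLawG.SteinFree

set_option maxHeartbeats 1600000 in
open AssemblyFinal in
/-- **STUB `stub_assembly` of line `birth`** (crux U `FreeProbeLawG`, stmt-QuantumFields-23756): the resummed Schwinger–Dyson
identities, the truncated Green `1`-forms and the field bounds turn the sharp budget of a torus-limit state into the near-annihilation of
the lattice-Maxwell block Ornstein–Uhlenbeck generator by the pair law, at rate `C (1+n)^K β^(−δ) (1+M)` (the body of C1ᶠ). See the module
docstring. -/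
theorem stub_assembly :
    ∀ (G : Type) [Group G] [TopologicalSpace G] [IsTopologicalGroup G] [CompactSpace G]
      [MeasurableSpace G] [BorelSpace G],
      Literature.MathematicalPhysics.QuantumFieldTheory.IsCompactSimpleLieGroup G →
      ∀ r : Literature.MathematicalPhysics.QuantumFieldTheory.LatticeRep G,
        (∀ E₀ : ℝ, ∃ Csd c κsd : ℝ, 0 < κsd ∧ 0 ≤ Csd ∧ ∀ β : ℝ, 1 ≤ β →
           ∀ μ ∈ Literature.MathematicalPhysics.QuantumLattice.infiniteVolumeLimitPoints (d := 4) r.ρ β,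
             (∀ (x : Literature.Probability.LatticeModels.Site 4) (i j : Fin 4), i ≠ j →
               β * (∫ U, ((r.N : ℝ) - Literature.MathematicalPhysics.QuantumLattice.plaquetteObs r.ρ x i j U) ∂μ) ≤ E₀) →
             ∀ (e : Literature.MathematicalPhysics.QuantumLattice.ZdEdge 4) (b : Fin (Summit.QuantumFields.YangMills.Theorems.EquipartitionPinsProbe.lieDim r)) (S : Finset (Literature.MathematicalPhysics.QuantumLattice.ZdPlaquette 4)) (ρS : ℕ),
               Literature.MathematicalPhysics.QuantumLattice.plaquettesTouching {e} ⊆ S → (∀ p ∈ S, ∀ k : Fin 4, |p.1 k| ≤ (ρS : ℤ)) →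
               ∀ (g : (↥S → Fin (Summit.QuantumFields.YangMills.Theorems.EquipartitionPinsProbe.lieDim r) → ℝ) → ℝ) (M : ℝ), 0 ≤ M → ContDiff ℝ 1 g →
                 (∀ y, |g y| ≤ 1) → (∀ y, ‖fderiv ℝ g y‖ ≤ M) →
                 |(∑ p : ↥S, Literature.MathematicalPhysics.QuantumFieldTheory.plaquetteCurl (fun e' => if e' = e then (1 : ℝ) else 0) (p : Literature.MathematicalPhysics.QuantumLattice.ZdPlaquette 4) *
                       ∫ U, fderiv ℝ g (fun q a => Summit.QuantumFields.YangMills.Theorems.EquipartitionPinsProbe.plaqField r β U (q : Literature.MathematicalPhysics.QuantumLattice.ZdPlaquette 4) a)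
                         (fun q a => if q = p ∧ a = b then (1 : ℝ) else 0) ∂μ) -
                     ∫ U, g (fun q a => Summit.QuantumFields.YangMills.Theorems.EquipartitionPinsProbe.plaqField r β U (q : Literature.MathematicalPhysics.QuantumLattice.ZdPlaquette 4) a) *
                       (∑ p ∈ S, Literature.MathematicalPhysics.QuantumFieldTheory.plaquetteCurl (fun e' => if e' = e then (1 : ℝ) else 0) p *
                         Summit.QuantumFields.YangMills.Theorems.EquipartitionPinsProbe.plaqField r β U p b) ∂μ| ≤
                   Csd * (1 + M) * (1 + (ρS : ℝ)) ^ c * β ^ (-κsd)) →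
        (∃ Cg c γ : ℝ, 0 < γ ∧ 0 ≤ Cg ∧ ∀ (p : Literature.MathematicalPhysics.QuantumLattice.ZdPlaquette 4) (R : ℕ), (∀ k : Fin 4, 2 * |p.1 k| + 2 ≤ (R : ℤ)) →
        ∃ ω : Literature.MathematicalPhysics.QuantumLattice.ZdEdge 4 → ℝ,
          (∀ e, ω e ≠ 0 → ∀ k : Fin 4, |e.1 k| ≤ (R : ℤ)) ∧
          (∀ T : Finset (Literature.MathematicalPhysics.QuantumLattice.ZdEdge 4), ∑ e ∈ T, |ω e| ≤ Cg * (1 + (R : ℝ)) ^ c) ∧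
          (∀ q : Literature.MathematicalPhysics.QuantumLattice.ZdPlaquette 4, (∀ k : Fin 4, 2 * |q.1 k| + 2 ≤ (R : ℤ)) →
            Literature.MathematicalPhysics.QuantumFieldTheory.plaquetteCurl ω q = Literature.MathematicalPhysics.QuantumFieldTheory.curvatureTwoPoint p q) ∧
          (∀ T : Finset (Literature.MathematicalPhysics.QuantumLattice.ZdPlaquette 4), (∀ q, Literature.MathematicalPhysics.QuantumFieldTheory.plaquetteCurl ω q ≠ 0 → q ∈ T) →
            |(∑ q ∈ T, (Literature.MathematicalPhysics.QuantumFieldTheory.plaquetteCurl ω q) ^ 2) - Literature.MathematicalPhysics.QuantumFieldTheory.curvatureTwoPoint p p| ≤ Cg * (1 + (R : ℝ)) ^ (-γ))) →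
        ((∀ β : ℝ, 0 < β → ∀ (x : Literature.Probability.LatticeModels.Site 4), (∀ k : Fin 4, k ≠ 0 → x k = 0) →
          ∀ U : Literature.MathematicalPhysics.QuantumLattice.LGConfig 4 G,
            ∑ a : Fin (Summit.QuantumFields.YangMills.Theorems.EquipartitionPinsProbe.lieDim r), (Summit.QuantumFields.YangMills.Theorems.EquipartitionPinsProbe.plaqField r β U (Literature.MathematicalPhysics.QuantumFieldTheory.plaquette12 (d := 4) (by norm_num) x) a) ^ 2 ≤
              2 * β * ((r.N : ℝ) - Literature.MathematicalPhysics.QuantumLattice.plaquetteObs r.ρ x 1 2 U)) ∧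
        (∀ E₀ : ℝ, ∃ Cm c : ℝ, 0 ≤ Cm ∧ ∀ β : ℝ, 1 ≤ β →
          ∀ μ ∈ Literature.MathematicalPhysics.QuantumLattice.infiniteVolumeLimitPoints (d := 4) r.ρ β,
            (∀ (x : Literature.Probability.LatticeModels.Site 4) (i j : Fin 4), i ≠ j →
              β * (∫ U, ((r.N : ℝ) - Literature.MathematicalPhysics.QuantumLattice.plaquetteObs r.ρ x i j U) ∂μ) ≤ E₀) →
            ∀ (p : Literature.MathematicalPhysics.QuantumLattice.ZdPlaquette 4) (a : Fin (Summit.QuantumFields.YangMills.Theorems.EquipartitionPinsProbe.lieDim r)),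
              MeasureTheory.Integrable (fun U => (Summit.QuantumFields.YangMills.Theorems.EquipartitionPinsProbe.plaqField r β U p a) ^ 2) μ ∧
              ∫ U, (Summit.QuantumFields.YangMills.Theorems.EquipartitionPinsProbe.plaqField r β U p a) ^ 2 ∂μ ≤ Cm * (1 + ∑ k : Fin 4, (|p.1 k| : ℝ)) ^ c)) →
        ∀ κ Cb : ℝ, 0 < κ →
        ∃ (K δ C β₀ : ℝ), 0 < δ ∧ 0 < C ∧ ∀ β : ℝ, β₀ ≤ β →
          ∀ μ ∈ Literature.MathematicalPhysics.QuantumLattice.infiniteVolumeLimitPoints (d := 4) r.ρ β,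
            (∀ (x : Literature.Probability.LatticeModels.Site 4) (i j : Fin 4), i ≠ j →
              |β * (∫ U, ((r.N : ℝ) - Literature.MathematicalPhysics.QuantumLattice.plaquetteObs r.ρ x i j U) ∂μ) -
                  (Summit.QuantumFields.YangMills.Theorems.EquipartitionPinsProbe.lieDim r : ℝ) / 4| ≤ Cb * β ^ (-κ)) →
            ∀ n : ℕ, 1 ≤ n → ∀ B : Finset (Literature.MathematicalPhysics.QuantumLattice.ZdPlaquette 4),
              B = {Literature.MathematicalPhysics.QuantumFieldTheory.plaquette12 (d := 4) (by norm_num) 0,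
                    Literature.MathematicalPhysics.QuantumFieldTheory.plaquette12 (d := 4) (by norm_num) (Pi.single (0 : Fin 4) (n : ℤ))} →
              ∀ (F : (↥B → Fin (Summit.QuantumFields.YangMills.Theorems.EquipartitionPinsProbe.lieDim r) → ℝ) → ℝ) (M : ℝ),
                0 ≤ M → ContDiff ℝ 2 F → (∀ x, ‖fderiv ℝ F x‖ ≤ 1) → (∀ x y, ‖fderiv ℝ F x - fderiv ℝ F y‖ ≤ M * ‖x - y‖) →
                |∫ U, Literature.MathematicalPhysics.QuantumFieldTheory.latticeMaxwellBlockGenerator B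
                    (Summit.QuantumFields.YangMills.Theorems.EquipartitionPinsProbe.lieDim r) F
                    (fun p a => Summit.QuantumFields.YangMills.Theorems.EquipartitionPinsProbe.plaqField r β U
                      (p : Literature.MathematicalPhysics.QuantumLattice.ZdPlaquette 4) a) ∂μ| ≤
                  C * (1 + (n : ℝ)) ^ K * β ^ (-δ) * (1 + M)  := by
  intro G _ _ _ _ _ _ hG r hSD hGr hF κ Cb hκ
  haveI : SecondCountableTopology G :=
    (r.continuous.isClosedEmbedding r.injective).isEmbedding.secondCountableTopology
  obtain ⟨Cg, cg, γ, hγ, hCg, hGreen⟩ := hGr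
  obtain ⟨hFa, hFb0⟩ := hF
  obtain ⟨Csd, csd, κsd, hκsd, hCsd, hSD1⟩ := hSD ((Summit.QuantumFields.YangMills.Theorems.EquipartitionPinsProbe.lieDim r : ℝ) / 4 + |Cb|)
  obtain ⟨Cm, cm, hCm, hFb1⟩ := hFb0 ((Summit.QuantumFields.YangMills.Theorems.EquipartitionPinsProbe.lieDim r : ℝ) / 4 + |Cb|)
  have hD0 : (0 : ℝ) ≤ (lieDim r : ℝ) := Nat.cast_nonneg _
  have hcg' : cg ≤ max cg 0 := le_max_left _ _
  have hcsd' : csd ≤ max csd 0 := le_max_left _ _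
  have hcm' : cm ≤ max cm 0 := le_max_left _ _
  have hcg0 : 0 ≤ max cg 0 := le_max_right _ _
  have hcsd0 : 0 ≤ max csd 0 := le_max_right _ _
  have hcm0 : 0 ≤ max cm 0 := le_max_right _ _
  set deg : ℝ := max csd 0 + 2 * max cg 0 + max cm 0 + 8 with hdeg
  have hdeg0 : 0 ≤ deg := by rw [hdeg]; positivity
  have hdeg8 : 8 ≤ deg := by rw [hdeg]; linarith
  set κ₀ : ℝ := κsd / (8 * (deg + 1)) with hκ₀
  have hκ₀0 : 0 < κ₀ := by rw [hκ₀]; positivity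
  have hκ₀deg : κ₀ * deg ≤ κsd / 8 := by
    rw [hκ₀, div_mul_eq_mul_div, div_le_div_iff₀ (by positivity) (by norm_num)]
    nlinarith
  set d₀ : ℝ := κsd / 4 with hd₀
  have hd₀0 : 0 < d₀ := by rw [hd₀]; positivity
  set l₀ : ℝ := min κ (min (κ₀ * γ) d₀) / 2 with hl₀
  have hl₀0 : 0 < l₀ := by
    rw [hl₀]; exact half_pos (lt_min hκ (lt_min (mul_pos hκ₀0 hγ) hd₀0))
  have hl₀κ : 2 * l₀ ≤ κ := by rw [hl₀]; linarith [min_le_left κ (min (κ₀ * γ) d₀)]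
  have hl₀γ : 2 * l₀ ≤ κ₀ * γ := by
    rw [hl₀]; linarith [min_le_right κ (min (κ₀ * γ) d₀), min_le_left (κ₀ * γ) d₀]
  have hl₀d : 2 * l₀ ≤ d₀ := by
    rw [hl₀]; linarith [min_le_right κ (min (κ₀ * γ) d₀), min_le_right (κ₀ * γ) d₀]
  clear_value deg κ₀ d₀ l₀
  set D : ℝ := (lieDim r : ℝ) with hDdef
  obtain ⟨a1, ha1⟩ : ∃ a : ℝ, a = 2 * D * Cg * (Csd * 2 ^ (max csd 0)) := ⟨_, rfl⟩
  obtain ⟨a2, ha2⟩ : ∃ a : ℝ, a = 4 * D * |Cb| := ⟨_, rfl⟩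
  obtain ⟨a3, ha3⟩ : ∃ a : ℝ, a = 6 * D ^ 2 * Cg * (Csd * 2 ^ (max csd 0)) * (1 + (D + 2) * (1 + 4000 * Cg)) := ⟨_, rfl⟩
  obtain ⟨a3b, ha3b⟩ : ∃ a : ℝ, a = 18 * D ^ 2 * Cg := ⟨_, rfl⟩
  obtain ⟨a4, ha4⟩ : ∃ a : ℝ, a = D * (D / 2 + 1) * (D * Cm * 5 ^ (max cm 0) * (2 + 3 * (4000 * Cg) ^ 2)) := ⟨_, rfl⟩
  obtain ⟨a5, ha5⟩ : ∃ a : ℝ, a = 2 * D := ⟨_, rfl⟩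
  obtain ⟨a6, ha6⟩ : ∃ a : ℝ, a = 2 * D * (D * Cm * 5 ^ (max cm 0) * (2 + 3 * (4000 * Cg) ^ 2)) := ⟨_, rfl⟩
  have ha10 : 0 ≤ a1 := by rw [ha1]; positivity
  have ha20 : 0 ≤ a2 := by rw [ha2]; positivity
  have ha30 : 0 ≤ a3 := by rw [ha3]; positivity
  have ha3b0 : 0 ≤ a3b := by rw [ha3b]; positivity
  have ha40 : 0 ≤ a4 := by rw [ha4]; positivity
  have ha50 : 0 ≤ a5 := by rw [ha5]; positivity
  have ha60 : 0 ≤ a6 := by rw [ha6]; positivity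
  have hκN : ∀ N : ℝ, 0 ≤ N → N ≤ deg → κ₀ * N ≤ κsd / 8 := fun N hN hNd =>
    (mul_le_mul_of_nonneg_left hNd hκ₀0.le).trans hκ₀deg
  refine ⟨deg, l₀, (a1 + a2 + a3 + a3b + a4 + a5 + a6 + 1) * 8 ^ deg, 1, hl₀0, by positivity, ?_⟩
  intro β hβ1 μ hμ hbud n hn B hB F M hM hF hF1 hF2
  have hβ0 : 0 < β := lt_of_lt_of_le one_pos hβ1
  haveI : IsProbabilityMeasure μ := by obtain ⟨_, _, hprob, _⟩ := hμ; exact hprob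
  have hequi : ∀ (x : Literature.Probability.LatticeModels.Site 4) (i j : Fin 4), i ≠ j →
      β * (∫ U, ((r.N : ℝ) - plaquetteObs r.ρ x i j U) ∂μ) ≤ (lieDim r : ℝ) / 4 + |Cb| := by
    intro x i j hij
    have h := (abs_le.1 (hbud x i j hij)).2
    have h' : Cb * β ^ (-κ) ≤ |Cb| := by
      have hb1 : β ^ (-κ) ≤ 1 := Real.rpow_le_one_of_one_le_of_nonpos hβ1 (by linarith)
      calc Cb * β ^ (-κ) ≤ |Cb| * β ^ (-κ) := mul_le_mul_of_nonneg_right (le_abs_self _) (Real.rpow_nonneg hβ0.le _)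
        _ ≤ |Cb| * 1 := mul_le_mul_of_nonneg_left hb1 (abs_nonneg _)
        _ = |Cb| := mul_one _
    linarith
  have hSDβ : ∀ (e : ZdEdge 4) (b : Fin (lieDim r)) (S : Finset (ZdPlaquette 4)) (ρS : ℕ),
      plaquettesTouching {e} ⊆ S → (∀ p ∈ S, ∀ k : Fin 4, |p.1 k| ≤ (ρS : ℤ)) →
      ∀ (g : (↥S → Fin (lieDim r) → ℝ) → ℝ) (M : ℝ), 0 ≤ M → ContDiff ℝ 1 g →
        (∀ y, |g y| ≤ 1) → (∀ y, ‖fderiv ℝ g y‖ ≤ M) →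
        |(∑ p : ↥S, plaquetteCurl (fun e' => if e' = e then (1 : ℝ) else 0) (p : ZdPlaquette 4) *
              ∫ U, fderiv ℝ g (fun q a => plaqField r β U (q : ZdPlaquette 4) a)
                (fun q a => if q = p ∧ a = b then (1 : ℝ) else 0) ∂μ) -
            ∫ U, g (fun q a => plaqField r β U (q : ZdPlaquette 4) a) *
              (∑ p ∈ S, plaquetteCurl (fun e' => if e' = e then (1 : ℝ) else 0) p * plaqField r β U p b) ∂μ| ≤
          Csd * (1 + M) * (1 + (ρS : ℝ)) ^ (max csd 0) * β ^ (-κsd) := by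
    intro e b S ρS hS hrad g M hM hg hg0 hg1
    refine (hSD1 β hβ1 μ hμ hequi e b S ρS hS hrad g M hM hg hg0 hg1).trans ?_
    have h1 : (1 + (ρS : ℝ)) ^ csd ≤ (1 + (ρS : ℝ)) ^ (max csd 0) :=
      Real.rpow_le_rpow_of_exponent_le (by have := Nat.cast_nonneg (α := ℝ) ρS; linarith) hcsd'
    exact mul_le_mul_of_nonneg_right (mul_le_mul_of_nonneg_left h1 (by positivity)) (Real.rpow_nonneg hβ0.le _)
  have hGreen' : ∀ (p : ZdPlaquette 4) (R : ℕ), (∀ k : Fin 4, 2 * |p.1 k| + 2 ≤ (R : ℤ)) →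
      ∃ ω : ZdEdge 4 → ℝ,
        (∀ e, ω e ≠ 0 → ∀ k : Fin 4, |e.1 k| ≤ (R : ℤ)) ∧
        (∀ T : Finset (ZdEdge 4), ∑ e ∈ T, |ω e| ≤ Cg * (1 + (R : ℝ)) ^ (max cg 0)) ∧
        (∀ q : ZdPlaquette 4, (∀ k : Fin 4, 2 * |q.1 k| + 2 ≤ (R : ℤ)) → plaquetteCurl ω q = curvatureTwoPoint p q) ∧
        (∀ T : Finset (ZdPlaquette 4), (∀ q, plaquetteCurl ω q ≠ 0 → q ∈ T) →
          |(∑ q ∈ T, (plaquetteCurl ω q) ^ 2) - curvatureTwoPoint p p| ≤ Cg * (1 + (R : ℝ)) ^ (-γ)) := by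
    intro p R hp
    obtain ⟨ω, h1, h2, h3, h4⟩ := hGreen p R hp
    refine ⟨ω, h1, fun T => (h2 T).trans ?_, h3, h4⟩
    exact mul_le_mul_of_nonneg_left (Real.rpow_le_rpow_of_exponent_le (by have := Nat.cast_nonneg (α := ℝ) R; linarith) hcg') hCg
  have hFbβ : ∀ (p : ZdPlaquette 4) (a : Fin (lieDim r)),
      Integrable (fun U => (plaqField r β U p a) ^ 2) μ ∧
      ∫ U, (plaqField r β U p a) ^ 2 ∂μ ≤ Cm * (1 + ∑ k : Fin 4, (|p.1 k| : ℝ)) ^ (max cm 0) := by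
    intro p a
    obtain ⟨h1, h2⟩ := hFb1 β hβ1 μ hμ hequi p a
    refine ⟨h1, h2.trans (mul_le_mul_of_nonneg_left (Real.rpow_le_rpow_of_exponent_le ?_ hcm') hCm)⟩
    have : 0 ≤ ∑ k : Fin 4, (|p.1 k| : ℝ) := Finset.sum_nonneg fun k _ => by positivity
    linarith
  set R : ℕ := ⌈β ^ κ₀⌉₊ + 2 * n + 2 with hRdef
  have hR : 2 * n + 2 ≤ R := by rw [hRdef]; omega
  set δ : ℝ := β ^ (-(2 * d₀)) with hδdef
  have hδ : 0 < δ := Real.rpow_pos_of_pos hβ0 _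
  have hδ1 : δ ≤ 1 := Real.rpow_le_one_of_one_le_of_nonpos hβ1 (by linarith)
  set lam : ℝ := β ^ l₀ with hlamdef
  have hlam : 0 < lam := Real.rpow_pos_of_pos hβ0 _
  clear_value R δ lam
  have hraw := AssemblyMain.raw_bound r hβ1 μ hCsd hSDβ hCg hGreen' (hFa β hβ0) hCm hcm0 hFbβ hbud n B hB F hM hF hF1 hF2
    R hR hδ hδ1 hlam
  refine hraw.trans ?_
  set P : ℝ := 1 + (R : ℝ) with hPdef
  clear_value P
  have hR0 : (0 : ℝ) ≤ R := Nat.cast_nonneg R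
  have hP1 : 1 ≤ P := by rw [hPdef]; linarith
  have hP0 : 0 < P := lt_of_lt_of_le one_pos hP1
  have hβκ₀ : 1 ≤ β ^ κ₀ := Real.one_le_rpow hβ1 hκ₀0.le
  have hPβ : β ^ κ₀ ≤ P := by
    rw [hPdef, hRdef]; push_cast
    have := Nat.le_ceil (β ^ κ₀)
    have h2 : (0 : ℝ) ≤ (n : ℝ) := Nat.cast_nonneg n
    linarith
  set Q : ℝ := 8 * (1 + (n : ℝ)) with hQdef
  clear_value Q
  have hn0 : (0 : ℝ) ≤ n := Nat.cast_nonneg n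
  have hQ1 : 1 ≤ Q := by rw [hQdef]; linarith
  have hPQ : P ≤ Q * β ^ κ₀ := by
    rw [hPdef, hRdef, hQdef]; push_cast
    have h1 : (⌈β ^ κ₀⌉₊ : ℝ) ≤ β ^ κ₀ + 1 := (Nat.ceil_lt_add_one (Real.rpow_nonneg hβ0.le _)).le
    have h2 : (n : ℝ) ≤ (n : ℝ) * β ^ κ₀ := le_mul_of_one_le_right hn0 hβκ₀
    linarith
  have hPγ : P ^ (-γ) ≤ β ^ (-(κ₀ * γ)) := by
    rw [Real.rpow_neg hP0.le, Real.rpow_neg hβ0.le, Real.rpow_mul hβ0.le]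
    exact inv_anti₀ (Real.rpow_pos_of_pos (lt_of_lt_of_le one_pos hβκ₀) _) (Real.rpow_le_rpow (by positivity) hPβ hγ.le)
  have hδhalf : δ ^ (-(1 / 2 : ℝ)) = β ^ d₀ := by
    rw [hδdef, ← Real.rpow_mul hβ0.le]; congr 1; ring
  have hδsqrt : Real.sqrt δ = β ^ (-d₀) := by
    rw [Real.sqrt_eq_rpow, hδdef, ← Real.rpow_mul hβ0.le]; congr 1; ring
  have hlaminv : lam⁻¹ = β ^ (-l₀) := by rw [hlamdef, Real.rpow_neg hβ0.le]
  have hPpow1 : ∀ t : ℝ, 0 ≤ t → 1 ≤ P ^ t := fun t ht => Real.one_le_rpow hP1 ht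
  have hε : Csd * (2 + (R : ℝ)) ^ (max csd 0) * β ^ (-κsd) ≤ (Csd * 2 ^ (max csd 0)) * P ^ (max csd 0) * β ^ (-κsd) := by
    have h1 : (2 + (R : ℝ)) ^ (max csd 0) ≤ (2 * P) ^ (max csd 0) :=
      Real.rpow_le_rpow (by positivity) (by rw [hPdef]; linarith) hcsd0
    rw [Real.mul_rpow (by norm_num) hP0.le] at h1
    have := mul_le_mul_of_nonneg_left h1 hCsd
    have := mul_le_mul_of_nonneg_right this (Real.rpow_nonneg hβ0.le (-κsd))
    linarith [this]
  have hCc1 : 1 + 4000 * Cg * P ^ (max cg 0 + 4) ≤ (1 + 4000 * Cg) * P ^ (max cg 0 + 4) := by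
    have h1 := hPpow1 (max cg 0 + 4) (by positivity)
    calc 1 + 4000 * Cg * P ^ (max cg 0 + 4) ≤ P ^ (max cg 0 + 4) + 4000 * Cg * P ^ (max cg 0 + 4) := by linarith
      _ = (1 + 4000 * Cg) * P ^ (max cg 0 + 4) := by ring
  have hCc2 : 2 + 3 * (4000 * Cg * P ^ (max cg 0 + 4)) ^ 2 ≤ (2 + 3 * (4000 * Cg) ^ 2) * P ^ (2 * max cg 0 + 8) := by
    have hsq : (P ^ (max cg 0 + 4)) ^ 2 = P ^ (2 * max cg 0 + 8) := by
      rw [← Real.rpow_natCast, ← Real.rpow_mul hP0.le]; congr 1; push_cast; ring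
    have h1 := hPpow1 (2 * max cg 0 + 8) (by positivity)
    calc 2 + 3 * (4000 * Cg * P ^ (max cg 0 + 4)) ^ 2 = 2 + 3 * (4000 * Cg) ^ 2 * P ^ (2 * max cg 0 + 8) := by
          rw [mul_pow, hsq]; ring
      _ ≤ 2 * P ^ (2 * max cg 0 + 8) + 3 * (4000 * Cg) ^ 2 * P ^ (2 * max cg 0 + 8) := by linarith
      _ = (2 + 3 * (4000 * Cg) ^ 2) * P ^ (2 * max cg 0 + 8) := by ring
  have hΛ : D * (Cm * (5 * P) ^ (max cm 0)) * (2 + 3 * (4000 * Cg * P ^ (max cg 0 + 4)) ^ 2) ≤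
      (D * Cm * 5 ^ (max cm 0) * (2 + 3 * (4000 * Cg) ^ 2)) * P ^ (max cm 0 + 2 * max cg 0 + 8) := by
    rw [Real.mul_rpow (by norm_num) hP0.le, show max cm 0 + 2 * max cg 0 + 8 = max cm 0 + (2 * max cg 0 + 8) by ring,
      Real.rpow_add hP0 (max cm 0) (2 * max cg 0 + 8)]
    have h0 : 0 ≤ D * (Cm * (5 ^ (max cm 0) * P ^ (max cm 0))) := by positivity
    have := mul_le_mul_of_nonneg_left hCc2 h0
    refine this.trans (le_of_eq ?_)
    ring
  have hT1 : 2 * D * ((Cg * P ^ (max cg 0)) * ((Csd * (2 + (R : ℝ)) ^ (max csd 0) * β ^ (-κsd)) * (1 + M))) ≤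
      a1 * Q ^ deg * β ^ (-l₀) * (1 + M) := by
    have h1 : 2 * D * ((Cg * P ^ (max cg 0)) * ((Csd * (2 + (R : ℝ)) ^ (max csd 0) * β ^ (-κsd)) * (1 + M))) ≤
        a1 * P ^ (max cg 0 + max csd 0) * β ^ (-κsd) * (1 + M) := by
      rw [Real.rpow_add hP0, ha1]
      have := mul_le_mul_of_nonneg_left hε (show 0 ≤ 2 * D * (Cg * P ^ (max cg 0)) * (1 + M) by positivity)
      refine le_trans (le_of_eq (by ring)) (this.trans (le_of_eq (by ring)))
    refine h1.trans (mul_le_mul_of_nonneg_right (mono_le ha10 hβ1 hP1 hQ1 hPQ (by positivity) ?_ ?_) (by linarith))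
    · rw [hdeg]; linarith
    · have := hκN (max cg 0 + max csd 0) (by positivity) (by rw [hdeg]; linarith)
      linarith
  have hT2 : 2 * D * (lam * (2 * |Cb| * β ^ (-κ))) ≤ a2 * Q ^ deg * β ^ (-l₀) := by
    have h1 : 2 * D * (lam * (2 * |Cb| * β ^ (-κ))) = a2 * P ^ (0 : ℝ) * β ^ (l₀ + -κ) := by
      rw [Real.rpow_zero, Real.rpow_add hβ0, hlamdef, ha2]; ring
    rw [h1]
    exact mono_le ha20 hβ1 hP1 hQ1 hPQ le_rfl hdeg0 (by rw [mul_zero, add_zero]; linarith [hl₀κ])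
  have hT3a : 2 * D * (lam * (3 * D * ((Cg * P ^ (max cg 0)) * ((Csd * (2 + (R : ℝ)) ^ (max csd 0) * β ^ (-κsd)) *
      (δ ^ (-(1 / 2 : ℝ)) + (D + 2) * (1 + 4000 * Cg * P ^ (max cg 0 + 4))))))) ≤ a3 * Q ^ deg * β ^ (-l₀) := by
    have hmix : δ ^ (-(1 / 2 : ℝ)) + (D + 2) * (1 + 4000 * Cg * P ^ (max cg 0 + 4)) ≤
        β ^ d₀ * ((1 + (D + 2) * (1 + 4000 * Cg)) * P ^ (max cg 0 + 4)) := by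
      rw [hδhalf]
      have h1 := hPpow1 (max cg 0 + 4) (by positivity)
      have h2 : 1 ≤ β ^ d₀ := Real.one_le_rpow hβ1 hd₀0.le
      have h3 : (D + 2) * (1 + 4000 * Cg * P ^ (max cg 0 + 4)) ≤ (D + 2) * ((1 + 4000 * Cg) * P ^ (max cg 0 + 4)) :=
        mul_le_mul_of_nonneg_left hCc1 (by positivity)
      have h4 : 0 ≤ (D + 2) * ((1 + 4000 * Cg) * P ^ (max cg 0 + 4)) := by positivity
      have hb1 : β ^ d₀ ≤ β ^ d₀ * P ^ (max cg 0 + 4) := le_mul_of_one_le_right (Real.rpow_nonneg hβ0.le _) h1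
      have hb2 : (D + 2) * ((1 + 4000 * Cg) * P ^ (max cg 0 + 4)) ≤ β ^ d₀ * ((D + 2) * ((1 + 4000 * Cg) * P ^ (max cg 0 + 4))) :=
        le_mul_of_one_le_left h4 h2
      calc β ^ d₀ + (D + 2) * (1 + 4000 * Cg * P ^ (max cg 0 + 4))
          ≤ β ^ d₀ * P ^ (max cg 0 + 4) + β ^ d₀ * ((D + 2) * ((1 + 4000 * Cg) * P ^ (max cg 0 + 4))) := by linarith
        _ = β ^ d₀ * ((1 + (D + 2) * (1 + 4000 * Cg)) * P ^ (max cg 0 + 4)) := by ring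
    have h1 : 2 * D * (lam * (3 * D * ((Cg * P ^ (max cg 0)) * ((Csd * (2 + (R : ℝ)) ^ (max csd 0) * β ^ (-κsd)) *
        (δ ^ (-(1 / 2 : ℝ)) + (D + 2) * (1 + 4000 * Cg * P ^ (max cg 0 + 4))))))) ≤
        a3 * P ^ (2 * max cg 0 + max csd 0 + 4) * β ^ (l₀ + (-κsd + d₀)) := by
      have hA : 0 ≤ 2 * D * (lam * (3 * D * (Cg * P ^ (max cg 0)))) := by positivity
      have step1 := mul_le_mul (hε) hmix (by positivity) (by positivity)
      have step2 := mul_le_mul_of_nonneg_left step1 hA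
      refine (le_of_eq (by ring)).trans (step2.trans (le_of_eq ?_))
      rw [ha3, hlamdef, show 2 * max cg 0 + max csd 0 + 4 = max cg 0 + (max csd 0 + (max cg 0 + 4)) by ring,
        Real.rpow_add hP0 (max cg 0) (max csd 0 + (max cg 0 + 4)), Real.rpow_add hP0 (max csd 0) (max cg 0 + 4),
        Real.rpow_add hP0 (max cg 0) 4, Real.rpow_add hβ0 l₀ (-κsd + d₀), Real.rpow_add hβ0 (-κsd) d₀]
      ring
    refine h1.trans (mono_le ha30 hβ1 hP1 hQ1 hPQ (by positivity) ?_ ?_)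
    · rw [hdeg]; linarith
    · have := hκN (2 * max cg 0 + max csd 0 + 4) (by positivity) (by rw [hdeg]; linarith)
      linarith
  have hT3b : 2 * D * (lam * (3 * D * (3 * (Cg * P ^ (-γ))))) ≤ a3b * Q ^ deg * β ^ (-l₀) := by
    have h1 : 2 * D * (lam * (3 * D * (3 * (Cg * P ^ (-γ))))) ≤ a3b * P ^ (0 : ℝ) * β ^ (l₀ + -(κ₀ * γ)) := by
      rw [Real.rpow_zero, Real.rpow_add hβ0, hlamdef, ha3b]
      have := mul_le_mul_of_nonneg_left hPγ (show 0 ≤ 18 * D ^ 2 * Cg * β ^ l₀ by positivity)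
      refine (le_of_eq (by ring)).trans (this.trans (le_of_eq (by ring)))
    exact h1.trans (mono_le ha3b0 hβ1 hP1 hQ1 hPQ le_rfl hdeg0 (by rw [mul_zero, add_zero]; linarith [hl₀γ]))
  have hT4 : 2 * D * (lam * (1 / 2 * δ * (D * (Cm * (5 * P) ^ (max cm 0)) * (2 + 3 * (4000 * Cg * P ^ (max cg 0 + 4)) ^ 2)) *
      (D / 2 + 1))) ≤ a4 * Q ^ deg * β ^ (-l₀) := by
    have h1 : 2 * D * (lam * (1 / 2 * δ * (D * (Cm * (5 * P) ^ (max cm 0)) * (2 + 3 * (4000 * Cg * P ^ (max cg 0 + 4)) ^ 2)) *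
        (D / 2 + 1))) ≤ a4 * P ^ (max cm 0 + 2 * max cg 0 + 8) * β ^ (l₀ + -(2 * d₀)) := by
      have hA : 0 ≤ D * (D / 2 + 1) * lam * δ := by positivity
      have := mul_le_mul_of_nonneg_left hΛ hA
      refine (le_of_eq (by ring)).trans (this.trans (le_of_eq ?_))
      rw [ha4, hlamdef, hδdef, Real.rpow_add hβ0]; ring
    refine h1.trans (mono_le ha40 hβ1 hP1 hQ1 hPQ (by positivity) ?_ ?_)
    · rw [hdeg]; linarith
    · have := hκN (max cm 0 + 2 * max cg 0 + 8) (by positivity) (by rw [hdeg]; linarith)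
      linarith
  have hT5 : 2 * D * lam⁻¹ ≤ a5 * Q ^ deg * β ^ (-l₀) := by
    rw [hlaminv, ha5]
    have h1 : 1 ≤ Q ^ deg := Real.one_le_rpow hQ1 hdeg0
    have h2 : 0 ≤ 2 * D * β ^ (-l₀) := by positivity
    calc 2 * D * β ^ (-l₀) = 2 * D * β ^ (-l₀) * 1 := (mul_one _).symm
      _ ≤ 2 * D * β ^ (-l₀) * Q ^ deg := mul_le_mul_of_nonneg_left h1 h2
      _ = 2 * D * Q ^ deg * β ^ (-l₀) := by ring
  have hT6 : 2 * D * (Real.sqrt δ * (D * (Cm * (5 * P) ^ (max cm 0)) * (2 + 3 * (4000 * Cg * P ^ (max cg 0 + 4)) ^ 2))) ≤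
      a6 * Q ^ deg * β ^ (-l₀) := by
    have h1 : 2 * D * (Real.sqrt δ * (D * (Cm * (5 * P) ^ (max cm 0)) * (2 + 3 * (4000 * Cg * P ^ (max cg 0 + 4)) ^ 2))) ≤
        a6 * P ^ (max cm 0 + 2 * max cg 0 + 8) * β ^ (-d₀) := by
      have hA : 0 ≤ 2 * D * Real.sqrt δ := by positivity
      have := mul_le_mul_of_nonneg_left hΛ hA
      refine (le_of_eq (by ring)).trans (this.trans (le_of_eq ?_))
      rw [ha6, hδsqrt]; ring
    refine h1.trans (mono_le ha60 hβ1 hP1 hQ1 hPQ (by positivity) ?_ ?_)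
    · rw [hdeg]; linarith
    · have := hκN (max cm 0 + 2 * max cg 0 + 8) (by positivity) (by rw [hdeg]; linarith)
      linarith
  have hQdeg : Q ^ deg = 8 ^ deg * (1 + (n : ℝ)) ^ deg := by
    rw [hQdef, Real.mul_rpow (by norm_num) (by positivity)]
  have hM1 : 1 ≤ 1 + M := by linarith
  have hcore : 0 ≤ Q ^ deg * β ^ (-l₀) := by positivity
  have hsplit : 2 * D * ((Cg * P ^ (max cg 0)) * ((Csd * (2 + (R : ℝ)) ^ (max csd 0) * β ^ (-κsd)) * (1 + M)) +
      (lam * (2 * |Cb| * β ^ (-κ) + 3 * D * ((Cg * P ^ (max cg 0)) * ((Csd * (2 + (R : ℝ)) ^ (max csd 0) * β ^ (-κsd)) *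
        (δ ^ (-(1 / 2 : ℝ)) + (D + 2) * (1 + 4000 * Cg * P ^ (max cg 0 + 4)))) + 3 * (Cg * P ^ (-γ))) +
        1 / 2 * δ * (D * (Cm * (5 * P) ^ (max cm 0)) * (2 + 3 * (4000 * Cg * P ^ (max cg 0 + 4)) ^ 2)) * (D / 2 + 1)) +
      lam⁻¹ + Real.sqrt δ * (D * (Cm * (5 * P) ^ (max cm 0)) * (2 + 3 * (4000 * Cg * P ^ (max cg 0 + 4)) ^ 2)))) =
    2 * D * ((Cg * P ^ (max cg 0)) * ((Csd * (2 + (R : ℝ)) ^ (max csd 0) * β ^ (-κsd)) * (1 + M))) +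
    2 * D * (lam * (2 * |Cb| * β ^ (-κ))) +
    2 * D * (lam * (3 * D * ((Cg * P ^ (max cg 0)) * ((Csd * (2 + (R : ℝ)) ^ (max csd 0) * β ^ (-κsd)) *
      (δ ^ (-(1 / 2 : ℝ)) + (D + 2) * (1 + 4000 * Cg * P ^ (max cg 0 + 4))))))) +
    2 * D * (lam * (3 * D * (3 * (Cg * P ^ (-γ))))) +
    2 * D * (lam * (1 / 2 * δ * (D * (Cm * (5 * P) ^ (max cm 0)) * (2 + 3 * (4000 * Cg * P ^ (max cg 0 + 4)) ^ 2)) *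
      (D / 2 + 1))) +
    2 * D * lam⁻¹ +
    2 * D * (Real.sqrt δ * (D * (Cm * (5 * P) ^ (max cm 0)) * (2 + 3 * (4000 * Cg * P ^ (max cg 0 + 4)) ^ 2))) := by
    ring
  rw [hsplit]
  have hsum : a1 * Q ^ deg * β ^ (-l₀) * (1 + M) + a2 * Q ^ deg * β ^ (-l₀) + a3 * Q ^ deg * β ^ (-l₀) +
      a3b * Q ^ deg * β ^ (-l₀) + a4 * Q ^ deg * β ^ (-l₀) + a5 * Q ^ deg * β ^ (-l₀) + a6 * Q ^ deg * β ^ (-l₀) ≤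
      (a1 + a2 + a3 + a3b + a4 + a5 + a6 + 1) * 8 ^ deg * (1 + (n : ℝ)) ^ deg * β ^ (-l₀) * (1 + M) := by
    rw [hQdeg] at hcore ⊢
    have hk : ∀ a : ℝ, 0 ≤ a → a * (8 ^ deg * (1 + (n : ℝ)) ^ deg) * β ^ (-l₀) ≤
        a * (8 ^ deg * (1 + (n : ℝ)) ^ deg) * β ^ (-l₀) * (1 + M) := fun a ha =>
      le_mul_of_one_le_right (by rw [mul_assoc]; exact mul_nonneg ha hcore) hM1
    have hG1 : 0 ≤ (8 ^ deg * (1 + (n : ℝ)) ^ deg) * β ^ (-l₀) * (1 + M) := mul_nonneg hcore (by linarith)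
    have e : (a1 + a2 + a3 + a3b + a4 + a5 + a6 + 1) * 8 ^ deg * (1 + (n : ℝ)) ^ deg * β ^ (-l₀) * (1 + M) =
        a1 * (8 ^ deg * (1 + (n : ℝ)) ^ deg) * β ^ (-l₀) * (1 + M) + a2 * (8 ^ deg * (1 + (n : ℝ)) ^ deg) * β ^ (-l₀) * (1 + M) +
        a3 * (8 ^ deg * (1 + (n : ℝ)) ^ deg) * β ^ (-l₀) * (1 + M) + a3b * (8 ^ deg * (1 + (n : ℝ)) ^ deg) * β ^ (-l₀) * (1 + M) +
        a4 * (8 ^ deg * (1 + (n : ℝ)) ^ deg) * β ^ (-l₀) * (1 + M) + a5 * (8 ^ deg * (1 + (n : ℝ)) ^ deg) * β ^ (-l₀) * (1 + M) +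
        a6 * (8 ^ deg * (1 + (n : ℝ)) ^ deg) * β ^ (-l₀) * (1 + M) + (8 ^ deg * (1 + (n : ℝ)) ^ deg) * β ^ (-l₀) * (1 + M) := by
      ring
    rw [e]
    linarith [hk a2 ha20, hk a3 ha30, hk a3b ha3b0, hk a4 ha40, hk a5 ha50, hk a6 ha60]
  linarith [hT1, hT2, hT3a, hT3b, hT4, hT5, hT6, hsum]


end Summit.QuantumFields.YangMills.Cruxes.FreeProbeLawG.SteinFree

end
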